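import Summits.AtomisticToContinuum.HydrodynamicLimit.Theses.InformationPercolationEngine

/-!
# Negative-lane helpers for crux `PercolationClosesChaos` (stmt-AtomisticToContinuum-13914):
collision-sphere kinematics and the orientation of the target's marks

Kernel-checked identities behind findings F3, F5, F6 of the standing disproof record
(`Cruxes/PercolationClosesChaos/Disproof.lean`) of the crux
`PercolationClosesChaos : KickIsotropyInfo → SpectralContractionR → ContactChaos`
(route InformationPercolationEngine). They assert no statement of the route, positively or negatively;
ideators, planners and provers of a re-filed engine may import them.

* **Collision sphere.** For the hard-sphere rule `collide ω (v, w) = (v − ⟪v−w, ω⟫ω, w + ⟪v−w, ω⟫ω)`: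
  `v′ = (v+w)/2 + m_ω`, `w′ = (v+w)/2 − m_ω` with `m_ω = (v−w)/2 − ⟪v−w, ω⟫ω`, `‖m_ω‖ = ‖v−w‖/2`
  (`collide_fst_eq_cm`, `collide_snd_eq_cm_sub`, `collide_fst_sub_cm_eq_neg`, `norm_half_sub_reflect`):
  both outgoing velocities lie on the sphere with diameter `[v, w]`, at ANTIPODAL points; exchanging the
  parents exchanges the outputs (`collide_fst_swap`). With `⟪v−w, m_ω⟫ = ‖v−w‖²/2 − ⟪v−w, ω⟫²`
  (`inner_half_sub_reflect`) the cosine between incoming and outgoing relative directions is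
  `1 − 2cos²θ`, uniform on `[−1, 1]` when `cos²θ` is (flux law) — Archimedes: the outgoing direction is
  uniform on `S²`. Consequences recorded in the Disproof file: the one-collision operator `K` of
  `SpectralContractionR` is the two-output (sibling) operator, hence PSD with joint-parent χ²-ratio
  `λ₂(K)` (F3), and the cross operator `E[f(w′) | v]` equals `K` (F5, typed there as `CrossOpEqOp`).
* **Energy bookkeeping.** `‖v′‖² = ‖v+w‖²/4 + ‖v−w‖²/4 + ⟪v+w, m_ω⟫` and
  `‖w′‖² = ‖v+w‖²/4 + ‖v−w‖²/4 − ⟪v+w, m_ω⟫` (`norm_sq_collide_fst`, `norm_sq_collide_snd`): each child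
  carries the parents' mean energy plus/minus a mean-zero increment — the conserved sector is transmitted
  with weight exactly ½ from each parent (critical, `2 · ½ = 1`).
* **Orientation of the target's marks (F6).** Along a hard-sphere trajectory, at every ordered contact pair
  the mark `(ω, v, w) = (ε⁻¹ sepVec x_i x_j, reflectVel (sepVec x_i x_j) (v_i, v_j))` that `ContactChaos`
  feeds to its test `Ψ` satisfies `0 < ⟪w − v, ω⟫` (`contactMark_inner_pos`): it lies in the support of the
  reference weight `hardSphereKernel (w, v) · = ((w−v)·)₊` of the same statement, so no `ω ↦ −ω` /
  pre-vs-post mismatch is available as a cheap kill of the target.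
-/

namespace Summit.AtomisticToContinuum.HydrodynamicLimit.Theorems.PercolationClosesChaos.Negative

open scoped InnerProductSpace RealInnerProductSpace

/-! ## The collision sphere -/

section Kinematics

open Literature.MathematicalPhysics.KineticTheory

/-- CM decomposition of the tagged outgoing velocity: `v′ = (v + w)/2 + ((v − w)/2 − ⟪v − w, ω⟫ ω)`.
[folklore] -/
theorem collide_fst_eq_cm (ω : Metric.sphere (0 : V3) 1) (v w : V3) :
    (collide ω (v, w)).1 =
      (1 / 2 : ℝ) • (v + w) + ((1 / 2 : ℝ) • (v - w) - ⟪v - w, (ω : V3)⟫_ℝ • (ω : V3)) := by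
  simp only [collide]
  module

/-- CM decomposition of the PARTNER's outgoing velocity: `w′ = (v + w)/2 − ((v − w)/2 − ⟪v − w, ω⟫ ω)`.
[folklore] -/
theorem collide_snd_eq_cm_sub (ω : Metric.sphere (0 : V3) 1) (v w : V3) :
    (collide ω (v, w)).2 =
      (1 / 2 : ℝ) • (v + w) - ((1 / 2 : ℝ) • (v - w) - ⟪v - w, (ω : V3)⟫_ℝ • (ω : V3)) := by
  simp only [collide]
  module

/-- The two outputs are antipodal about the centre of mass: `v′ − (v+w)/2 = −(w′ − (v+w)/2)`. [folklore] -/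
theorem collide_fst_sub_cm_eq_neg (ω : Metric.sphere (0 : V3) 1) (v w : V3) :
    (collide ω (v, w)).1 - (1 / 2 : ℝ) • (v + w) = -((collide ω (v, w)).2 - (1 / 2 : ℝ) • (v + w)) := by
  simp only [collide]
  module

/-- Parent-exchange symmetry: the tagged output with the parents exchanged is the partner's output,
`(collide ω (w, v)).1 = (collide ω (v, w)).2`. [folklore] -/
theorem collide_fst_swap (ω : Metric.sphere (0 : V3) 1) (v w : V3) :
    (collide ω (w, v)).1 = (collide ω (v, w)).2 := by
  simp only [collide]
  rw [← neg_sub v w, inner_neg_left, neg_smul, sub_neg_eq_add]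

/-- The reflected half relative velocity has norm `‖q‖/2`: the outgoing velocities lie on the sphere with
diameter `[v, w]` whatever the impact vector. [folklore] -/
theorem norm_half_sub_reflect (ω : Metric.sphere (0 : V3) 1) (q : V3) :
    ‖(1 / 2 : ℝ) • q - ⟪q, (ω : V3)⟫_ℝ • (ω : V3)‖ = ‖q‖ / 2 := by
  have hω : ‖(ω : V3)‖ = 1 := norm_eq_of_mem_sphere ω
  have h2 : ‖(1 / 2 : ℝ) • q - ⟪q, (ω : V3)⟫_ℝ • (ω : V3)‖ ^ 2 = (‖q‖ / 2) ^ 2 := by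
    rw [norm_sub_sq_real, norm_smul, norm_smul, real_inner_smul_left, real_inner_smul_right, hω,
      Real.norm_eq_abs, Real.norm_eq_abs, mul_one, mul_pow, sq_abs, sq_abs]
    ring
  have ha : 0 ≤ ‖(1 / 2 : ℝ) • q - ⟪q, (ω : V3)⟫_ℝ • (ω : V3)‖ := norm_nonneg _
  have hb : 0 ≤ ‖q‖ / 2 := by positivity
  nlinarith [h2, ha, hb, sq_nonneg (‖(1 / 2 : ℝ) • q - ⟪q, (ω : V3)⟫_ℝ • (ω : V3)‖ - ‖q‖ / 2)]

/-- Cosine of the outgoing relative direction against the incoming one: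
`⟪q, q/2 − ⟪q, ω⟫ ω⟫ = ‖q‖²/2 − ⟪q, ω⟫²`, i.e. `⟪q̂, n⟫ = 1 − 2 ⟪q̂, ω⟫²` — uniform on `[−1, 1]` when
`⟪q̂, ω⟫²` is uniform on `[0, 1]` (the flux law), so `n` is uniform on `S²` (Archimedes). [folklore] -/
theorem inner_half_sub_reflect (ω : Metric.sphere (0 : V3) 1) (q : V3) :
    ⟪q, (1 / 2 : ℝ) • q - ⟪q, (ω : V3)⟫_ℝ • (ω : V3)⟫_ℝ = ‖q‖ ^ 2 / 2 - ⟪q, (ω : V3)⟫_ℝ ^ 2 := by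
  rw [inner_sub_right, real_inner_smul_right, real_inner_smul_right, real_inner_self_eq_norm_sq]
  ring

/-- Energy bookkeeping of the tagged child: `‖v′‖² = ‖v + w‖²/4 + ‖v − w‖²/4 + ⟪v + w, m_ω⟫`. [folklore] -/
theorem norm_sq_collide_fst (ω : Metric.sphere (0 : V3) 1) (v w : V3) :
    ‖(collide ω (v, w)).1‖ ^ 2 =
      ‖v + w‖ ^ 2 / 4 + ‖v - w‖ ^ 2 / 4 +
        ⟪v + w, (1 / 2 : ℝ) • (v - w) - ⟪v - w, (ω : V3)⟫_ℝ • (ω : V3)⟫_ℝ := by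
  rw [collide_fst_eq_cm, norm_add_sq_real, norm_smul, Real.norm_eq_abs, mul_pow, sq_abs,
    norm_half_sub_reflect, real_inner_smul_left]
  ring

/-- Energy bookkeeping of the partner child: `‖w′‖² = ‖v + w‖²/4 + ‖v − w‖²/4 − ⟪v + w, m_ω⟫` — the
increments of the two children cancel (pair energy conserved), each child gets the parents' MEAN energy
plus a mean-zero increment. [folklore] -/
theorem norm_sq_collide_snd (ω : Metric.sphere (0 : V3) 1) (v w : V3) :
    ‖(collide ω (v, w)).2‖ ^ 2 =
      ‖v + w‖ ^ 2 / 4 + ‖v - w‖ ^ 2 / 4 -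
        ⟪v + w, (1 / 2 : ℝ) • (v - w) - ⟪v - w, (ω : V3)⟫_ℝ • (ω : V3)⟫_ℝ := by
  rw [collide_snd_eq_cm_sub, norm_sub_sq_real, norm_smul, Real.norm_eq_abs, mul_pow, sq_abs,
    norm_half_sub_reflect, real_inner_smul_left]
  ring

end Kinematics

/-! ## Orientation of the marks tested by `ContactChaos` -/

section Convention

open Literature.Analysis.FluidPDE

variable {d : Type*} [Fintype d] {X : Type*} [TopologicalSpace X] {N : ℕ}
  {G : Geometry d X} {ε : ℝ} {γ : ℝ → Config N d X}

/-- **The target's marks are incoming for its own kernel.** Along a hard-sphere trajectory, at every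
ordered contact pair `(i, j)` the mark `(ω, v, w)` that `ContactChaos` feeds to `Ψ` — `ω = ε⁻¹ sepVec x_i x_j`,
`(v, w) = reflectVel (sepVec x_i x_j) (v_i, v_j)` — satisfies `0 < ⟪w − v, ω⟫`, the support condition of the
reference weight `hardSphereKernel (w, v) · = ((w − v)·)₊` (right-continuity of trajectories +
`IsHardSphereTrajectory.inner_sepVec_preVel_neg`). [folklore] -/
theorem contactMark_inner_pos (hε : 0 < ε) (h : IsHardSphereTrajectory G ε N γ) {t : ℝ} {i j : Fin N}
    (hp : (i, j) ∈ contactPairs G ε (γ t)) :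
    0 < ⟪(reflectVel (G.sepVec (γ t i).1 (γ t j).1) ((γ t i).2, (γ t j).2)).2 -
          (reflectVel (G.sepVec (γ t i).1 (γ t j).1) ((γ t i).2, (γ t j).2)).1,
        ε⁻¹ • G.sepVec (γ t i).1 (γ t j).1⟫_ℝ := by
  have hneg := h.inner_sepVec_preVel_neg hp
  simp only [HardSphereCollisionRecord.ofConfig_preVel] at hneg
  rw [real_inner_smul_right, ← neg_sub, inner_neg_left, real_inner_comm]
  have hinv : 0 < ε⁻¹ := inv_pos.2 hε
  nlinarith

end Convention

end Summit.AtomisticToContinuum.HydrodynamicLimit.Theorems.PercolationClosesChaos.Negative
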